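import Summits.HodgeConjecture.HodgeConjecture.Theorems.Ring2WeilCoverageCMFieldRationalClassesSplitFibreRoots
import Summits.HodgeConjecture.HodgeConjecture.Theorems.Ring2WeilCoverageCMFieldRationalClassesPrimeSupportCyclic
import Summits.HodgeConjecture.HodgeConjecture.Theorems.Ring2WeilCoverageCMFieldAllPrimesV
import Summits.HodgeConjecture.HodgeConjecture.Theorems.Ring2WeilCoverageCMFieldNormResidueSymbolsDyadicRamifiedCarriers
import Mathlib.NumberTheory.LegendreSymbol.QuadraticReciprocity
import HarnessLib

/-!
# Ring 2 — Weil-family coverage, CM-field rows: the rational classes of the NON-GALOIS table `E = ℚ(√-(3+√2))` — the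
  places over `7`, the inert primes, the lonely primes (WEIL-FAMILY-COVERAGE «## b03», cell (xxi⁹), part 54)

research route conditional on HC_CM; not a corollary; Q11.4-sentence-2 already refuted in dim ≥ 3.

Carrier `R = S² + 6S + 7` (`θ = -3 ± √2`, `θθ' = q = 7`, `p² - 4q = 8`; `F = ℚ(√2)`, `E = F(√θ)` of type `D₄`; rows
labelled by `T(t) = {𝔭 : (t, θ)_𝔭 = -1}`) [cite: Deligne1982HodgeCycles, §4 (1), Cor. 4.2].  b03.22/b03.32 observed that
here the rational rows are NOT fibre-constant (integer rows `[1173]`, `[697]`, … made of «lonely» places).  Part 53 explains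
why — `q = 7` is not a square — and this file makes the prime-level structure explicit:

* §154 `(7|ℓ)` as a congruence mod `28` (quadratic reciprocity, Mathlib); squares mod `7`.
* §155 **THE TWO PLACES OVER `7`**: `𝔭_θ ∋ θ` and `𝔭' ∋ θ - 1`, both of norm `7` with `ord 7 = 1`; **`𝔭'` lies in NO
  `T(ℓ)`** (`θ ≡ 1` there); **`𝔭_θ ∈ T(ℓ) ⟺ ℓ ≡ 3, 5, 6 (mod 7) ∨ ℓ = 7`** (63:11a at the odd place `𝔭_θ`, `ord θ = 1`;
  `ℓ = 7` by parity: `T(7) ⊆ {(√2), 𝔭_θ}` is non-empty and even); an odd place `v ∌ θ` in `T(ℓ)` contains `ℓ`.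
* §156 **INERT primes** `ℓ ≡ ±3 (mod 8)`: **`(ℓ) ∈ T(ℓ) ⟺ (7|ℓ) = -1`** (parts 47/53); **SPLIT primes** `ℓ ≡ ±1 (mod 8)`,
  `ℓ ≠ 7`: the two places `v ≠ v'` over `ℓ` satisfy **`v ∈ T(ℓ) ⟺ v' ∈ T(ℓ)` if `(7|ℓ) = 1`, and `v ∈ T(ℓ) ⟺ v' ∉ T(ℓ)`
  if `(7|ℓ) = -1`** — the LONELY primes: exactly one of the two places is bad (part 53).
* §157 **RATIONAL CLASSES**: for `c ∈ ℚ_{>0}`: `𝔭' ∉ T(c)`; `𝔭_θ ∈ T(c) ⟺` the number of prime factors `ℓ ≡ 3,5,6,0 (mod 7)`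
  of `num(c)·den(c)`, with multiplicity, is odd; an odd place `v ∌ θ` over `ℓ`: `v ∈ T(c) ⟺ ord_ℓ(c)` odd `∧ v ∈ T(ℓ)`;
  the dyadic place by parity (part 9's `dFour_inl_mem_badPlaces_dyadic_iff`).

No new definition, no named fact, no sorry; nothing about the Hodge conjecture is asserted.
-/

noncomputable section

set_option linter.dupNamespace false

open Polynomial NumberField IsDedekindDomain

namespace Summit.HodgeConjecture.HodgeConjecture.Ring2.WeilCoverageCM

open Literature.AlgebraicGeometry.Deligne1982
open Literature.AlgebraicGeometry.HodgeTheory (splitDiscriminantClassCM)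
open Literature.NumberTheory.QuadraticForms

variable {R : Polynomial ℤ} [Fact (Irreducible (cmPolyQ R))] [Fact (Irreducible (realPolyQ R))]

/-! ### §154 Squares mod `7` and `(7|ℓ)` -/

/-- `IsSquare (n : ZMod 7) ⟺ n mod 7 ∈ {0, 1, 2, 4}`. [folklore] -/
theorem isSquare_natCast_zmod_seven_iff (n : ℕ) :
    IsSquare (n : ZMod 7) ↔ n % 7 = 0 ∨ n % 7 = 1 ∨ n % 7 = 2 ∨ n % 7 = 4 := by
  rw [← ZMod.natCast_mod n 7]
  obtain ⟨r, hr, hn⟩ : ∃ r, r < 7 ∧ n % 7 = r := ⟨_, Nat.mod_lt _ (by norm_num), rfl⟩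
  rw [hn]
  interval_cases r <;> decide

/-- **`(7|ℓ) = 1 ⟺ ℓ mod 28 ∈ {1, 3, 9, 19, 25, 27}`** for a prime `ℓ ≠ 2, 7` (quadratic reciprocity: `7 ≡ 3 (mod 4)`).
[folklore] -/
theorem isSquare_seven_iff {ℓ : ℕ} (hℓ : ℓ.Prime) (h2 : ℓ ≠ 2) (h7 : ℓ ≠ 7) :
    IsSquare (7 : ZMod ℓ) ↔ ℓ % 28 = 1 ∨ ℓ % 28 = 3 ∨ ℓ % 28 = 9 ∨ ℓ % 28 = 19 ∨ ℓ % 28 = 25 ∨ ℓ % 28 = 27 := by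
  haveI := Fact.mk hℓ
  haveI : Fact (Nat.Prime 7) := ⟨by norm_num⟩
  have hodd : ℓ % 2 = 1 := (Nat.Prime.mod_two_eq_one_iff_ne_two hℓ).2 h2
  have h70 : ℓ % 7 ≠ 0 := fun h ↦ h7 ((Nat.prime_dvd_prime_iff_eq (by norm_num : (7 : ℕ).Prime) hℓ).1
    (Nat.dvd_of_mod_eq_zero h)).symm
  have hsq7 := isSquare_natCast_zmod_seven_iff ℓ
  have e : IsSquare (7 : ZMod ℓ) ↔ IsSquare ((7 : ℕ) : ZMod ℓ) := by norm_num
  obtain ⟨k, r, hr, hkr⟩ : ∃ k r, r < 28 ∧ ℓ = 28 * k + r := ⟨ℓ / 28, ℓ % 28, Nat.mod_lt _ (by norm_num), (Nat.div_add_mod ℓ 28).symm⟩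
  by_cases h4 : ℓ % 4 = 1
  · have key := ZMod.exists_sq_eq_prime_iff_of_mod_four_eq_one (p := ℓ) (q := 7) h4 (by norm_num)
    rw [e, key, hsq7, hkr]
    rw [hkr] at h4 h70
    interval_cases r <;> omega
  · have h4' : ℓ % 4 = 3 := by omega
    have key := ZMod.exists_sq_eq_prime_iff_of_mod_four_eq_three (p := ℓ) (q := 7) h4' (by norm_num) h7
    rw [e, key, hsq7, hkr]
    rw [hkr] at h4' h70
    interval_cases r <;> omega

/-! ### §155 `ℚ(√-(3+√2))`: the two places over `7`, and the odd places against `T(ℓ)` -/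

section DFour

omit [Fact (Irreducible (cmPolyQ R))] in
/-- **The two places of `F = ℚ(√2)` over `7`** for the carrier `R = S² + 6S + 7`: `𝔭_θ ∋ θ` and `𝔭' ∋ θ - 1` (`R ≡ S(S-1)
mod 7`), distinct, of norm `7`, with `ord 7 = 1`, exhausting the places over `7`. [folklore] -/
theorem dFour_places_over_seven (hR : R = X ^ 2 + C 6 * X + C 7) {θₒ : 𝓞 (realField R)}
    (hθ : (θₒ : realField R) = AdjoinRoot.root (realPolyQ R)) :
    ∃ v v' : HeightOneSpectrum (𝓞 (realField R)), v ≠ v' ∧ ((7 : ℕ) : 𝓞 (realField R)) ∈ v.asIdeal ∧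
      ((7 : ℕ) : 𝓞 (realField R)) ∈ v'.asIdeal ∧ θₒ ∈ v.asIdeal ∧ θₒ - 1 ∈ v'.asIdeal ∧
      Ideal.absNorm v.asIdeal = 7 ∧ Ideal.absNorm v'.asIdeal = 7 ∧
      v.intValuation ((7 : ℕ) : 𝓞 (realField R)) = WithZero.exp (-1 : ℤ) ∧
      v'.intValuation ((7 : ℕ) : 𝓞 (realField R)) = WithZero.exp (-1 : ℤ) ∧
      ∀ u : HeightOneSpectrum (𝓞 (realField R)), ((7 : ℕ) : 𝓞 (realField R)) ∈ u.asIdeal → u = v ∨ u = v' := by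
  have h7 : (7 : ℕ).Prime := by norm_num
  have hdsq : IsSquare (((6 : ℤ) ^ 2 - 4 * 7 : ℤ) : ZMod 7) := ⟨1, by decide⟩
  obtain ⟨r, v, v', ⟨m, hm⟩, hne, h7v, h7v', hr, hr', hN, hN', ho, ho', hall⟩ :=
    exists_labelled_places_of_isSquare_disc hR hθ h7 (by norm_num) (by norm_num) hdsq
  have h7v_ : ((7 : ℤ) : 𝓞 (realField R)) ∈ v.asIdeal := by exact_mod_cast h7v
  have h7v'_ : ((7 : ℤ) : 𝓞 (realField R)) ∈ v'.asIdeal := by exact_mod_cast h7v'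
  -- `7 ∣ R(r) = r(r+6) + 7`: `7 ∣ r` or `7 ∣ r + 6`
  have hdvd : (7 : ℤ) ∣ r * (r + 6) := ⟨m - 1, by linear_combination hm⟩
  rcases ((by norm_num : Prime (7 : ℤ)).dvd_mul).1 hdvd with h | h
  · -- `θ ∈ v`, `θ - 1 ∈ v'`
    obtain ⟨a, ha⟩ := h
    have ha' := congrArg (fun z : ℤ ↦ (z : 𝓞 (realField R))) ha
    push_cast at ha'
    refine ⟨v, v', hne, h7v, h7v', ?_, ?_, hN, hN', ho, ho', hall⟩
    · have e : θₒ = (θₒ - r) + ((7 : ℤ) : 𝓞 (realField R)) * (a : 𝓞 (realField R)) := by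
        push_cast; linear_combination ha'
      rw [e]; exact v.asIdeal.add_mem hr (v.asIdeal.mul_mem_right _ h7v_)
    · have e : θₒ - 1 = (θₒ + r + (6 : ℤ)) - ((7 : ℤ) : 𝓞 (realField R)) * ((a : 𝓞 (realField R)) + 1) := by
        push_cast; linear_combination -ha'
      rw [e]; exact v'.asIdeal.sub_mem hr' (v'.asIdeal.mul_mem_right _ h7v'_)
  · -- `7 ∣ r + 6`: `θ - 1 ∈ v`, `θ ∈ v'`: swap
    obtain ⟨a, ha⟩ := h
    have ha' := congrArg (fun z : ℤ ↦ (z : 𝓞 (realField R))) ha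
    push_cast at ha'
    refine ⟨v', v, hne.symm, h7v', h7v, ?_, ?_, hN', hN, ho', ho, fun u hu ↦ (hall u hu).symm⟩
    · have e : θₒ = (θₒ + r + (6 : ℤ)) - ((7 : ℤ) : 𝓞 (realField R)) * (a : 𝓞 (realField R)) := by
        push_cast; linear_combination -ha'
      rw [e]; exact v'.asIdeal.sub_mem hr' (v'.asIdeal.mul_mem_right _ h7v'_)
    · have e : θₒ - 1 = (θₒ - r) + ((7 : ℤ) : 𝓞 (realField R)) * ((a : 𝓞 (realField R)) - 1) := by
        push_cast; linear_combination ha'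
      rw [e]; exact v.asIdeal.add_mem hr (v.asIdeal.mul_mem_right _ h7v_)

/-- **`𝔭'` (the place over `7` with `θ ≡ 1`) lies in NO `T(ℓ)`** (`θ` is a unit and a square mod `𝔭'`; 63:11a/63:12).
[cite: Omeara1963, §63B Cor. 63:11a and Example 63:12] [cite: Deligne1982HodgeCycles, §4 (1)] -/
theorem dFour_inl_notMem_badPlaces_natCast_of_root_sub_one_mem {θₒ : 𝓞 (realField R)}
    (hθ : (θₒ : realField R) = AdjoinRoot.root (realPolyQ R)) (v : HeightOneSpectrum (𝓞 (realField R)))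
    (h7 : ((7 : ℕ) : 𝓞 (realField R)) ∈ v.asIdeal) (h1 : θₒ - 1 ∈ v.asIdeal) {ℓ : ℕ} (hℓ : ℓ.Prime) :
    Sum.inl v ∉ badPlaces (ℓ : realField R) (AdjoinRoot.root (realPolyQ R)) := by
  have h2 := two_notMem_of_natCast_mem (by norm_num : (7 : ℕ).Prime) (by norm_num) v h7
  have hθv : θₒ ∉ v.asIdeal := fun h ↦ v.isPrime.ne_top ((Ideal.eq_top_iff_one _).2 (by
    have e : (1 : 𝓞 (realField R)) = θₒ - (θₒ - 1) := by ring
    rw [e]; exact v.asIdeal.sub_mem h h1))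
  have hfac : AdjoinRoot.root (realPolyQ R) = (1 : realField R) ^ 2 * (θₒ : realField R) := by rw [one_pow, one_mul, hθ]
  rw [inl_mem_badPlaces_natCast_iff_of_notMem hfac v h2 hθv hℓ, not_and]
  intro hns
  exact absurd ⟨1, by rw [mul_one, ← map_one (Ideal.Quotient.mk v.asIdeal), Ideal.Quotient.eq]; exact h1⟩ hns

/-- **`𝔭_θ` (the place over `7` containing `θ`) lies in `T(ℓ)` iff `ℓ ≡ 3, 5, 6 (mod 7)` or `ℓ = 7`** (`ℓ ≠ 7`: `ℓ` is a
unit, `ord θ = 1`, 63:11a, squares mod `7` are `1, 2, 4`; `ℓ = 7`: `T(7) ⊆ {(√2), 𝔭_θ}` is non-empty — `[7] ≠ [1]`, part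
X-V — and even). [cite: Omeara1963, §63B Cor. 63:11a and §71D Thm. 71:18] [cite: Deligne1982HodgeCycles, §4 (1)] -/
theorem dFour_inl_mem_badPlaces_natCast_iff_of_root_mem (hR : R = X ^ 2 + C 6 * X + C 7) {θₒ : 𝓞 (realField R)}
    (hθ : (θₒ : realField R) = AdjoinRoot.root (realPolyQ R)) (v : HeightOneSpectrum (𝓞 (realField R)))
    (h7 : ((7 : ℕ) : 𝓞 (realField R)) ∈ v.asIdeal) (hθv : θₒ ∈ v.asIdeal) {ℓ : ℕ} (hℓ : ℓ.Prime) :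
    Sum.inl v ∈ badPlaces (ℓ : realField R) (AdjoinRoot.root (realPolyQ R)) ↔
      (ℓ % 7 = 3 ∨ ℓ % 7 = 5 ∨ ℓ % 7 = 6) ∨ ℓ = 7 := by
  have hK := finrank_realField_quadratic hR
  have hsev : (7 : ℕ).Prime := by norm_num
  have hrel := ringOfIntegers_root_rel_quadratic hR hθ
  push_cast at hrel
  obtain ⟨w, w', hww', h7w, h7w', hθw, h1w', hNw, -, how, -, hall⟩ := dFour_places_over_seven hR hθ
  -- `v = 𝔭_θ = w`
  have hvw : v = w := by
    rcases hall v h7 with h | h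
    · exact h
    · exfalso; subst h
      exact v.isPrime.ne_top ((Ideal.eq_top_iff_one _).2 (by
        have e : (1 : 𝓞 (realField R)) = θₒ - (θₒ - 1) := by ring
        rw [e]; exact v.asIdeal.sub_mem hθv h1w'))
  subst hvw
  have h2 := two_notMem_of_natCast_mem hsev (by norm_num) v h7
  have h7Z : ((7 : ℤ) : 𝓞 (realField R)) ∈ v.asIdeal := by exact_mod_cast h7
  by_cases hℓ7 : ℓ = 7
  · subst hℓ7
    refine iff_of_true ?_ (Or.inr rfl)
    -- `T(7) ⊆ {(√2), 𝔭_θ}`, non-empty, of even size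
    have h70 : ((7 : ℕ) : realField R) ≠ 0 := by norm_num
    have hne := (badPlaces_nonempty_iff_mk_ne_splitDiscriminantClassCM (R := R) (Units.mk0 ((7 : ℕ) : realField R) h70)
      even_two).2 ((sqrtNegThreePlusSqrtTwo_mk_prime_ne_splitDiscriminantClassCM_iff' hR 7 hsev _
        (by rw [Units.val_mk0])).2 (by norm_num))
    rw [Units.val_mk0] at hne
    have hroots := roots_real_neg_of_quadratic hR (by norm_num) (by norm_num) (by norm_num)
    have hfac : AdjoinRoot.root (realPolyQ R) = (1 : realField R) ^ 2 * (θₒ : realField R) := by rw [one_pow, one_mul, hθ]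
    have hπ : (θₒ + 3) ^ 2 = 2 * 1 := by rw [dFour_sq_eq_two hR hθ, mul_one]
    by_contra hv
    -- every bad place is the dyadic one
    have hsub : ∀ x ∈ badPlaces ((7 : ℕ) : realField R) (AdjoinRoot.root (realPolyQ R)),
        ∃ u : HeightOneSpectrum (𝓞 (realField R)), x = Sum.inl u ∧ (2 : 𝓞 (realField R)) ∈ u.asIdeal := by
      rintro (u | u') hx
      · refine ⟨u, rfl, ?_⟩
        by_contra h2u
        by_cases hθu : θₒ ∈ u.asIdeal
        · have h7u : ((7 : ℤ) : 𝓞 (realField R)) ∈ u.asIdeal := intCast_mem_of_root_mem hR hθ u hθu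
          rcases hall u (by exact_mod_cast h7u) with h | h
          · exact hv (by rwa [h] at hx)
          · exact (dFour_inl_notMem_badPlaces_natCast_of_root_sub_one_mem hθ w' h7w' h1w' hsev) (by rwa [h] at hx)
        · have h7u := natCast_mem_of_inl_mem_badPlaces hfac u h2u hθu hsev hx
          rcases hall u h7u with h | h
          · exact hθu (by rw [h]; exact hθw)
          · exact (dFour_inl_notMem_badPlaces_natCast_of_root_sub_one_mem hθ w' h7w' h1w' hsev) (by rwa [h] at hx)
      · exact absurd hx (inr_notMem_badPlaces_natCast hroots u' hsev)
    obtain ⟨x₀, hx₀⟩ := hne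
    obtain ⟨u₀, rfl, h2u₀⟩ := hsub x₀ hx₀
    have heq : badPlaces ((7 : ℕ) : realField R) (AdjoinRoot.root (realPolyQ R)) = {Sum.inl u₀} := by
      apply Set.Subset.antisymm
      · intro x hx
        obtain ⟨u, rfl, h2u⟩ := hsub x hx
        rw [Set.mem_singleton_iff, dyadic_unique_of_sq_eq_two_mul_unit hK isUnit_one hπ u u₀ h2u h2u₀]
      · rintro x hx; rw [Set.mem_singleton_iff] at hx; rw [hx]; exact hx₀
    have heven := (even_ncard_badPlaces (R := R) (Units.mk0 ((7 : ℕ) : realField R) h70)).2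
    rw [Units.val_mk0, heq, Set.ncard_singleton] at heven
    exact (Nat.not_even_iff_odd.2 odd_one) heven
  -- `ℓ ≠ 7`: the closed form at the odd place `𝔭_θ`
  have hℓv : (ℓ : 𝓞 (realField R)) ∉ v.asIdeal := fun h ↦ hℓ7 (prime_natCast_mem_unique hℓ hsev v h h7)
  have hθ' : -θₒ - 6 ∉ v.asIdeal := fun h ↦ by
    have h6 : ((6 : ℤ) : 𝓞 (realField R)) ∈ v.asIdeal := by
      have e : ((6 : ℤ) : 𝓞 (realField R)) = -(-θₒ - 6) - θₒ := by push_cast; ring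
      rw [e]; exact v.asIdeal.sub_mem (v.asIdeal.neg_mem h) hθv
    exact intCast_notMem_of_isCoprime v (show IsCoprime (7 : ℤ) 6 by norm_num) h7Z h6
  have hodd : Odd (WithZero.log (v.valuation (realField R) ((θₒ : 𝓞 (realField R)) : realField R))) := by
    -- `θ · θ' = 7`, `θ' ∉ v`, `ord_v 7 = 1`
    have hprod : θₒ * (-θₒ - 6) = ((7 : ℕ) : 𝓞 (realField R)) := by push_cast; linear_combination -hrel
    have h0 := log_valuation_coe_eq_zero_of_notMem v hθ'
    have hθne : ((θₒ : 𝓞 (realField R)) : realField R) ≠ 0 := by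
      rw [hθ]; exact root_realPolyQ_ne_zero
    have hθ'ne : (((-θₒ - 6 : 𝓞 (realField R))) : realField R) ≠ 0 := fun h ↦ hθ' (by
      rw [show -θₒ - 6 = 0 from RingOfIntegers.coe_injective (by simpa using h)]; exact v.asIdeal.zero_mem)
    have h7F : v.valuation (realField R) ((7 : ℕ) : realField R) = WithZero.exp (-1 : ℤ) := by
      rw [show ((7 : ℕ) : realField R) = algebraMap (𝓞 (realField R)) (realField R) ((7 : ℕ) : 𝓞 (realField R)) by
        rw [map_natCast], HeightOneSpectrum.valuation_of_algebraMap, how]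
    have hmul : v.valuation (realField R) ((θₒ : 𝓞 (realField R)) : realField R) *
        v.valuation (realField R) (((-θₒ - 6 : 𝓞 (realField R))) : realField R) = WithZero.exp (-1 : ℤ) := by
      rw [← map_mul, ← h7F]
      congr 1
      have h := congrArg (algebraMap (𝓞 (realField R)) (realField R)) hprod
      rwa [map_mul, map_natCast] at h
    have e := congrArg WithZero.log hmul
    rw [WithZero.log_mul ((Valuation.ne_zero_iff _).2 hθne) ((Valuation.ne_zero_iff _).2 hθ'ne), h0, add_zero,
      WithZero.log_exp] at e
    rw [e]; decide
  have hfac : AdjoinRoot.root (realPolyQ R) = (1 : realField R) ^ 2 * (θₒ : realField R) := by rw [one_pow, one_mul, hθ]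
  have key := inl_mem_badPlaces_coe_iff_of_notMem hfac v h2 (u := (ℓ : 𝓞 (realField R))) hℓv
  rw [show (((ℓ : 𝓞 (realField R))) : realField R) = (ℓ : realField R) from map_natCast (algebraMap _ _) ℓ] at key
  rw [key, and_iff_left hodd]
  have e := isSquare_intCast_residue_iff_of_absNorm_eq v hsev hNw ℓ
  rw [Int.cast_natCast, Int.cast_natCast] at e
  rw [e, isSquare_natCast_zmod_seven_iff]
  have h0 : ℓ % 7 ≠ 0 := fun h ↦ hℓ7 ((Nat.prime_dvd_prime_iff_eq hsev hℓ).1 (Nat.dvd_of_mod_eq_zero h)).symm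
  omega

/-- `ℚ(√-(3+√2))`: **an odd place not containing `θ` that lies in `T(ℓ)` contains `ℓ`** (63:12). [cite: Omeara1963, §63B
Example 63:12] -/
theorem dFour_natCast_mem_of_inl_mem_badPlaces {θₒ : 𝓞 (realField R)}
    (hθ : (θₒ : realField R) = AdjoinRoot.root (realPolyQ R)) (v : HeightOneSpectrum (𝓞 (realField R)))
    (h2 : (2 : 𝓞 (realField R)) ∉ v.asIdeal) (hθv : θₒ ∉ v.asIdeal) {ℓ : ℕ} (hℓ : ℓ.Prime)
    (hv : Sum.inl v ∈ badPlaces (ℓ : realField R) (AdjoinRoot.root (realPolyQ R))) : (ℓ : 𝓞 (realField R)) ∈ v.asIdeal := by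
  have hfac : AdjoinRoot.root (realPolyQ R) = (1 : realField R) ^ 2 * (θₒ : realField R) := by rw [one_pow, one_mul, hθ]
  exact natCast_mem_of_inl_mem_badPlaces hfac v h2 hθv hℓ hv

/-! ### §156 `ℚ(√-(3+√2))`: inert primes and lonely primes -/

/-- **INERT PRIMES `ℓ ≡ ±3 (mod 8)`: `(ℓ) ∈ T(ℓ) ⟺ (7|ℓ) = -1`** (the place over `ℓ` is unique, of norm `ℓ²`; parts 47/53 with
`q = 7`). [cite: Omeara1963, §63B Example 63:12] [cite: Deligne1982HodgeCycles, §4 (1)] -/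
theorem dFour_inl_mem_badPlaces_natCast_iff_of_inert (hR : R = X ^ 2 + C 6 * X + C 7) {θₒ : 𝓞 (realField R)}
    (hθ : (θₒ : realField R) = AdjoinRoot.root (realPolyQ R)) {ℓ : ℕ} (hℓ : ℓ.Prime) (hin : ℓ % 8 = 3 ∨ ℓ % 8 = 5)
    (v : HeightOneSpectrum (𝓞 (realField R))) (hℓv : (ℓ : 𝓞 (realField R)) ∈ v.asIdeal) :
    Sum.inl v ∈ badPlaces (ℓ : realField R) (AdjoinRoot.root (realPolyQ R)) ↔ ¬ IsSquare (7 : ZMod ℓ) := by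
  haveI := Fact.mk hℓ
  have hℓ2 : ℓ ≠ 2 := by rintro rfl; omega
  have hn2 : ¬ IsSquare (2 : ZMod ℓ) := by rw [ZMod.exists_sq_eq_two_iff hℓ2]; omega
  have h20 : (2 : ZMod ℓ) ≠ 0 := by exact_mod_cast natCast_prime_ne_zero_zmod Nat.prime_two hℓ2
  have hdisc : ¬ IsSquare (((6 : ℤ) ^ 2 - 4 * 7 : ℤ) : ZMod ℓ) := by
    have e : (((6 : ℤ) ^ 2 - 4 * 7 : ℤ) : ZMod ℓ) = 2 * 2 ^ 2 := by push_cast; norm_num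
    rw [e, isSquare_mul_sq_iff_of_ne_zero h20]; exact hn2
  have hℓ7 : ¬ (ℓ : ℤ) ∣ 7 := fun h ↦ by
    have := (Nat.prime_dvd_prime_iff_eq hℓ (by norm_num : (7 : ℕ).Prime)).1 (by exact_mod_cast h)
    omega
  rw [inl_mem_badPlaces_natCast_iff_of_not_isSquare_disc hR hθ hℓ hℓ2 hdisc hℓ7 v hℓv]
  push_cast
  exact Iff.rfl

/-- **SPLIT PRIMES `ℓ ≡ ±1 (mod 8)`, `ℓ ≠ 7`: the two places `v ≠ v'` over `ℓ` are TOGETHER in or out of `T(ℓ)` when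
`(7|ℓ) = 1`, and EXACTLY ONE of them is in `T(ℓ)` when `(7|ℓ) = -1`** (the «lonely» primes of the table — part 53's labelled
fibre with `q = 7`). [cite: Omeara1963, §63B Cor. 63:11a and Example 63:12] [cite: Deligne1982HodgeCycles, §4 (1)] -/
theorem dFour_fibre_iff_isSquare_seven (hR : R = X ^ 2 + C 6 * X + C 7) {θₒ : 𝓞 (realField R)}
    (hθ : (θₒ : realField R) = AdjoinRoot.root (realPolyQ R)) {ℓ : ℕ} (hℓ : ℓ.Prime) (hsp : ℓ % 8 = 1 ∨ ℓ % 8 = 7)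
    (hℓ7 : ℓ ≠ 7) :
    ∃ v v' : HeightOneSpectrum (𝓞 (realField R)), v ≠ v' ∧ (ℓ : 𝓞 (realField R)) ∈ v.asIdeal ∧
      (ℓ : 𝓞 (realField R)) ∈ v'.asIdeal ∧
      (∀ u : HeightOneSpectrum (𝓞 (realField R)), (ℓ : 𝓞 (realField R)) ∈ u.asIdeal → u = v ∨ u = v') ∧
      ((Sum.inl v ∈ badPlaces (ℓ : realField R) (AdjoinRoot.root (realPolyQ R)) ↔
          Sum.inl v' ∈ badPlaces (ℓ : realField R) (AdjoinRoot.root (realPolyQ R))) ↔ IsSquare (7 : ZMod ℓ)) := by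
  haveI := Fact.mk hℓ
  have hℓ2 : ℓ ≠ 2 := by rintro rfl; omega
  have h20 : (2 : ZMod ℓ) ≠ 0 := by exact_mod_cast natCast_prime_ne_zero_zmod Nat.prime_two hℓ2
  have hdsq : IsSquare (((6 : ℤ) ^ 2 - 4 * 7 : ℤ) : ZMod ℓ) := by
    have e : (((6 : ℤ) ^ 2 - 4 * 7 : ℤ) : ZMod ℓ) = 2 * 2 ^ 2 := by push_cast; norm_num
    rw [e, isSquare_mul_sq_iff_of_ne_zero h20, ZMod.exists_sq_eq_two_iff hℓ2]; exact hsp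
  have hℓdisc : ¬ (ℓ : ℤ) ∣ (6 : ℤ) ^ 2 - 4 * 7 := fun h ↦ by
    have h' : ℓ ∣ 2 ^ 3 * 3 ^ 0 * 5 ^ 0 := by norm_num at h ⊢; exact_mod_cast h
    rcases eq_of_prime_dvd_two_pow_mul hℓ h' with rfl | rfl | rfl <;> omega
  have hℓq : ¬ (ℓ : ℤ) ∣ 7 := fun h ↦ hℓ7 ((Nat.prime_dvd_prime_iff_eq hℓ (by norm_num : (7 : ℕ).Prime)).1 (by exact_mod_cast h))
  obtain ⟨r, v, v', hrR, hne, hℓv, hℓv', hr, hr', hN, hN', ho, ho', hall⟩ :=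
    exists_labelled_places_of_isSquare_disc hR hθ hℓ hℓ2 hℓdisc hdsq
  refine ⟨v, v', hne, hℓv, hℓv', hall, ?_⟩
  have h := inl_mem_badPlaces_natCast_iff_iff_isSquare_const hR hθ hℓ hℓ2 hℓq hrR v v' hℓv hℓv' hN hN' ho ho' hr hr'
  rw [h]; push_cast; exact Iff.rfl

/-! ### §157 `ℚ(√-(3+√2))`: rational classes at the places over `7` and at the odd places not containing `θ` -/

/-- **`𝔭'` lies in no rational class `T(c)`, `c ∈ ℚ_{>0}`.** [cite: Deligne1982HodgeCycles, §4 (1)] -/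
theorem dFour_inl_notMem_badPlaces_ratCast_of_root_sub_one_mem {θₒ : 𝓞 (realField R)}
    (hθ : (θₒ : realField R) = AdjoinRoot.root (realPolyQ R)) (v : HeightOneSpectrum (𝓞 (realField R)))
    (h7 : ((7 : ℕ) : 𝓞 (realField R)) ∈ v.asIdeal) (h1 : θₒ - 1 ∈ v.asIdeal) {c : ℚ} (hc : 0 < c) :
    Sum.inl v ∉ badPlaces (c : realField R) (AdjoinRoot.root (realPolyQ R)) :=
  notMem_badPlaces_ratCast_of_forall_prime _
    (fun _ hℓ ↦ dFour_inl_notMem_badPlaces_natCast_of_root_sub_one_mem hθ v h7 h1 hℓ) hc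

/-- **`𝔭_θ ∈ T(c)` iff the number of prime factors `ℓ ≡ 0, 3, 5, 6 (mod 7)` of `num(c)·den(c)`, counted with multiplicity,
is odd** (`c ∈ ℚ_{>0}`; parity of the prime support, part 46). [cite: Deligne1982HodgeCycles, §4 (1)] [cite: Omeara1963, §63B] -/
theorem dFour_inl_mem_badPlaces_ratCast_iff_of_root_mem (hR : R = X ^ 2 + C 6 * X + C 7) {θₒ : 𝓞 (realField R)}
    (hθ : (θₒ : realField R) = AdjoinRoot.root (realPolyQ R)) (v : HeightOneSpectrum (𝓞 (realField R)))
    (h7 : ((7 : ℕ) : 𝓞 (realField R)) ∈ v.asIdeal) (hθv : θₒ ∈ v.asIdeal) {c : ℚ} (hc : 0 < c) :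
    Sum.inl v ∈ badPlaces (c : realField R) (AdjoinRoot.root (realPolyQ R)) ↔
      Odd ((c.num.natAbs * c.den).factorization.sum
        fun ℓ e ↦ if (ℓ % 7 = 3 ∨ ℓ % 7 = 5 ∨ ℓ % 7 = 6) ∨ ℓ = 7 then e else 0) :=
  mem_badPlaces_ratCast_iff_odd_sum_factorization _ (fun ℓ ↦ (ℓ % 7 = 3 ∨ ℓ % 7 = 5 ∨ ℓ % 7 = 6) ∨ ℓ = 7)
    (fun _ hℓ ↦ dFour_inl_mem_badPlaces_natCast_iff_of_root_mem hR hθ v h7 hθv hℓ) hc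

/-- **An odd place `v ∌ θ` over the prime `ℓ`: `v ∈ T(c) ⟺ ord_ℓ(c)` is odd `∧ v ∈ T(ℓ)`** (`c ∈ ℚ_{>0}`; prime support,
part 41 — the value of `v ∈ T(ℓ)` being §156's: `(7|ℓ)` at inert `ℓ`, the square class of the root labelling `v` at split
`ℓ`). [cite: Deligne1982HodgeCycles, §4 (1)] [cite: Omeara1963, §63B Example 63:12] -/
theorem dFour_inl_mem_badPlaces_ratCast_iff_of_root_notMem {θₒ : 𝓞 (realField R)}
    (hθ : (θₒ : realField R) = AdjoinRoot.root (realPolyQ R)) (v : HeightOneSpectrum (𝓞 (realField R)))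
    (h2 : (2 : 𝓞 (realField R)) ∉ v.asIdeal) (hθv : θₒ ∉ v.asIdeal) {ℓ : ℕ} (hℓ : ℓ.Prime)
    (hℓv : (ℓ : 𝓞 (realField R)) ∈ v.asIdeal) {c : ℚ} (hc : 0 < c) :
    Sum.inl v ∈ badPlaces (c : realField R) (AdjoinRoot.root (realPolyQ R)) ↔
      Odd (padicValRat ℓ c) ∧ Sum.inl v ∈ badPlaces (ℓ : realField R) (AdjoinRoot.root (realPolyQ R)) :=
  mem_badPlaces_ratCast_iff_of_prime_support _ hℓ
    (fun _ hℓ' hne h ↦ hne (prime_natCast_mem_unique hℓ' hℓ v (dFour_natCast_mem_of_inl_mem_badPlaces hθ v h2 hθv hℓ' h) hℓv)) hc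

end DFour

end Summit.HodgeConjecture.HodgeConjecture.Ring2.WeilCoverageCM

end
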